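import Summits.BirchSwinnertonDyer.BirchSwinnertonDyer.Theorems.SlopeDichotomyA2DegenerateLocusA2PrimeSupport
import Summits.BirchSwinnertonDyer.Rank1Residual.EisensteinPrimesSupport
import HarnessLib

/-!
# The SHARP prime support of corner A2: the crux `DegenerateLocusA2` (item stmt-BirchSwinnertonDyer-19086)
# is a statement at the FOUR primes `3, 5, 7, 13` — by name, in the kernel

Support file (prover seat `bsd-schneider-i1-c2`, gen 14, cell `bsd-schneider-ideate`; `--supports
stmt-BirchSwinnertonDyer-19086`). THEOREMS ONLY, conditional on two PUBLISHED named facts of the tree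
(Mazur 1978 Thm. 1 `mazur_isogeny_irreducible`; the `j`-table of the rational isogenies of prime degree
`ℓ ∈ {11, 17, 19, 37, 43, 67, 163}` `primeDegreeIsogeny_jTable`, Cremona *Algorithms* §3.8 p. 82 /
Mazur 1978 table p. 129 / Ligozat 1975 / Mazur–Swinnerton-Dyer 1974) and, where complex multiplication
is removed, on Bertrand 1984 and Gross–Zagier–Kolyvagin as in the gen-10 file; nothing unconditional
about any curve, nothing booked; BSD is not advanced. Sequel of
`SlopeDichotomyA2DegenerateLocusA2PrimeSupport.lean` (gen 10), whose §1 puts corner A2 on the ELEVEN odd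
Mazur primes `{3, 5, 7, 11, 13, 17, 19, 37, 43, 67, 163}` and whose module docstring records the
refinement to `{3, 5, 7, 13}` as an UNTYPED numerical remark (kit j267726). That refinement is in fact a
kernel theorem of the tree: the b2b cell's tool file `Summits/BirchSwinnertonDyer/Rank1Residual/
EisensteinPrimesSupport.lean` proves `EisensteinPrimes.mem_of_classX1 : ClassX1 W p → p ∈ {3, 5, 7, 13}`
granted the two facts — at `ℓ ∈ {11, 17, 19, 43, 67, 163}` every tabulated `j` has `ord_ℓ j ∈ {1, 2}`
or `ord_ℓ (j − 1728) = 1`, impossible at a prime of good reduction (`ord_ℓ j = 3·ord_ℓ c₄`,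
`ord_ℓ (j − 1728) = 2·ord_ℓ c₆` on the minimal model), and at `ℓ = 37` the two `X₀(37)` classes have
`a₃₇ = ±8 ≢ 1 (mod 37)` (kernel point counts `#Ẽ(𝔽₃₇) = 30` transported along `j` to every twist).
This file records the consequences for the route BY NAME:

* §1 `mem_primeSupport_of_typeBRankOne` — **corner A2 lives at `p ∈ {3, 5, 7, 13}`**
  (`eq_or_of_typeBRankOne`, `prime_le_thirteen_of_typeBRankOne`); `not_typeBRankOne_of_not_mem` —
  the corner is EMPTY at every other prime, in particular (`not_typeBRankOne_of_mem_positiveGenus`) at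
  the seven positive-genus odd Mazur primes `11, 17, 19, 37, 43, 67, 163` of the gen-10 normal form.
* §2 `bsdp_of_degenerate_of_not_mem` / `bsdp_of_degenerate_of_mem_positiveGenus` — the crux's
  instance at any prime outside `{3, 5, 7, 13}` HOLDS (vacuously, class-wide): seven of the eleven
  conjuncts of `DegenerateLocusA2PrimeSupport.degenerateLocusA2_iff_of_mem_oddMazurPrimes` are
  discharged by name; the four that remain are exactly the census primes (2 444 / 292 / 53 / 8
  class-pairs `N < 5·10⁵` at `p = 3 / 5 / 7 / 13`).
* §3 `degenerateLocusA2_iff_of_mem_primeSupport`, `degenerateLocusA2_iff_nonCM_of_mem_primeSupport` —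
  the crux is EQUIVALENT to its restriction to `p ∈ {3, 5, 7, 13}` (and to non-CM curves there).
* §4 the same normal forms for K5's crux `EisensteinPrimes.SchneiderOnX1TypeB` (item 19036) and for
  the rung-I1 leaf `SchneiderWeaken.TypeBRankOneUnridered`.

The item's verdict is unchanged (DECIDED-REDUCED: 19086 ⟸ 19036; 19086 ⟺ 19035 modulo Keller–Yin
Thm. 3.0.8 + PUB); this file only replaces "eleven primes" by "four primes" in every WLOG form.

References: [Mazur1978] Thm. 1 and table p. 129; [CremonaAlgorithms1997] §3.8 p. 82;
[MazurSwinnertonDyer1974] §5; [Bertrand1984ThetaCM] §3 Cor. 1; cell files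
`run/shared/lean/pub/bsd-schneider-ideate/memos/i1-c2/`.
-/

set_option autoImplicit false
set_option linter.dupNamespace false

noncomputable section

open scoped Classical

open WeierstrassCurve Literature.NumberTheory.EllipticCurves
  Literature.NumberTheory.EllipticCurves.Rank1Residual
  Summit.BirchSwinnertonDyer.Rank1Residual

namespace Summit.BirchSwinnertonDyer.BirchSwinnertonDyer.Theorems.DegenerateLocusA2PrimeSupportSharp

/-! ## §1 The sharp prime support of corner A2 -/

/-- **Corner A2 lives at `p ∈ {3, 5, 7, 13}`**: a corner-A2 pair (`X1.TypeBRankOne W p`) is in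
particular an X1 pair (`ClassX1 W p`: `p > 2`, `E[p]` reducible, good, anomalous), and the tree's
`EisensteinPrimes.mem_of_classX1` puts `p` in `{3, 5, 7, 13}` granted Mazur 1978 Thm. 1 (`hM`) and the
prime-degree isogeny `j`-table (`hT`). [cite: Mazur1978, Thm. 1 and table p. 129]
[cite: CremonaAlgorithms1997, §3.8 p. 82] -/
theorem mem_primeSupport_of_typeBRankOne (hM : mazur_isogeny_irreducible)
    (hT : primeDegreeIsogeny_jTable) (W : WeierstrassCurve ℚ) [W.IsElliptic] [W.IsGloballyMinimal]
    (p : ℕ) [Fact p.Prime] (hB : X1.TypeBRankOne W p) : p ∈ ({3, 5, 7, 13} : Finset ℕ) :=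
  Summit.BirchSwinnertonDyer.Rank1Residual.EisensteinPrimes.mem_of_classX1 hM hT W p hB.1

/-- The same as a disjunction: at a corner-A2 pair `p = 3 ∨ p = 5 ∨ p = 7 ∨ p = 13`.
[cite: Mazur1978, Thm. 1 and table p. 129] [cite: CremonaAlgorithms1997, §3.8 p. 82] -/
theorem eq_or_of_typeBRankOne (hM : mazur_isogeny_irreducible) (hT : primeDegreeIsogeny_jTable)
    (W : WeierstrassCurve ℚ) [W.IsElliptic] [W.IsGloballyMinimal] (p : ℕ) [Fact p.Prime]
    (hB : X1.TypeBRankOne W p) : p = 3 ∨ p = 5 ∨ p = 7 ∨ p = 13 :=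
  Summit.BirchSwinnertonDyer.Rank1Residual.EisensteinPrimes.eq_or_of_classX1 hM hT W p hB.1

/-- In particular `p ≤ 13` at every corner-A2 pair (gen 10 had `p ≤ 163`).
[cite: Mazur1978, Thm. 1 and table p. 129] [cite: CremonaAlgorithms1997, §3.8 p. 82] -/
theorem prime_le_thirteen_of_typeBRankOne (hM : mazur_isogeny_irreducible)
    (hT : primeDegreeIsogeny_jTable) (W : WeierstrassCurve ℚ) [W.IsElliptic] [W.IsGloballyMinimal]
    (p : ℕ) [Fact p.Prime] (hB : X1.TypeBRankOne W p) : p ≤ 13 := by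
  rcases eq_or_of_typeBRankOne hM hT W p hB with rfl | rfl | rfl | rfl <;> omega

/-- **Corner A2 is EMPTY at every prime outside `{3, 5, 7, 13}`.**
[cite: Mazur1978, Thm. 1 and table p. 129] [cite: CremonaAlgorithms1997, §3.8 p. 82] -/
theorem not_typeBRankOne_of_not_mem (hM : mazur_isogeny_irreducible) (hT : primeDegreeIsogeny_jTable)
    (W : WeierstrassCurve ℚ) [W.IsElliptic] [W.IsGloballyMinimal] (p : ℕ) [Fact p.Prime]
    (hp : p ∉ ({3, 5, 7, 13} : Finset ℕ)) : ¬ X1.TypeBRankOne W p :=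
  fun hB ↦ hp (mem_primeSupport_of_typeBRankOne hM hT W p hB)

/-- **Corner A2 is EMPTY at the seven positive-genus odd Mazur primes `11, 17, 19, 37, 43, 67, 163`**
(the primes of the gen-10 normal form that are not census primes): at `11, 17, 19, 43, 67, 163` no curve
with a rational `p`-isogeny has good reduction at `p`, and at `37` none is anomalous.
[cite: Mazur1978, Thm. 1 and table p. 129] [cite: MazurSwinnertonDyer1974, §5]
[cite: CremonaAlgorithms1997, §3.8 p. 82] -/
theorem not_typeBRankOne_of_mem_positiveGenus (hM : mazur_isogeny_irreducible)
    (hT : primeDegreeIsogeny_jTable) (W : WeierstrassCurve ℚ) [W.IsElliptic] [W.IsGloballyMinimal]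
    (p : ℕ) [Fact p.Prime] (hp : p ∈ ({11, 17, 19, 37, 43, 67, 163} : Finset ℕ)) :
    ¬ X1.TypeBRankOne W p := by
  refine not_typeBRankOne_of_not_mem hM hT W p ?_
  simp only [Finset.mem_insert, Finset.mem_singleton] at hp ⊢
  omega

/-! ## §2 The crux's instances outside `{3, 5, 7, 13}` hold (vacuously, class-wide) -/

/-- **The crux `DegenerateLocusA2` at any prime outside `{3, 5, 7, 13}` HOLDS**, class-wide and for the
trivial reason that corner A2 is empty there (granted `hM`, `hT`): for such `p`, every globally minimal
`W` with `X1.TypeBRankOne W p` and a degenerate canonical datum satisfies `BSD(W, p)` — there is no such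
`W`. Nothing about BSD at the census primes is claimed. [cite: Mazur1978, Thm. 1 and table p. 129]
[cite: CremonaAlgorithms1997, §3.8 p. 82] -/
theorem bsdp_of_degenerate_of_not_mem (hM : mazur_isogeny_irreducible)
    (hT : primeDegreeIsogeny_jTable) (W : WeierstrassCurve ℚ) [W.IsElliptic] [W.IsGloballyMinimal]
    (p : ℕ) [Fact p.Prime] (hp : p ∉ ({3, 5, 7, 13} : Finset ℕ)) (hB : X1.TypeBRankOne W p)
    (_hD : ∃ Dh : PAdicHeightData W p, Dh.IsCanonical ∧ ¬ SchneiderConjecture Dh) : BSDp W p :=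
  absurd hB (not_typeBRankOne_of_not_mem hM hT W p hp)

/-- **Seven of the eleven conjuncts of the gen-10 normal form are discharged**: the crux's instance at
each positive-genus odd Mazur prime `p ∈ {11, 17, 19, 37, 43, 67, 163}` holds (vacuously); the four
conjuncts that remain are the census primes `3, 5, 7, 13` (2 444 / 292 / 53 / 8 class-pairs
`N < 5·10⁵`). [cite: Mazur1978, Thm. 1 and table p. 129] [cite: MazurSwinnertonDyer1974, §5]
[cite: CremonaAlgorithms1997, §3.8 p. 82] -/
theorem bsdp_of_degenerate_of_mem_positiveGenus (hM : mazur_isogeny_irreducible)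
    (hT : primeDegreeIsogeny_jTable) (W : WeierstrassCurve ℚ) [W.IsElliptic] [W.IsGloballyMinimal]
    (p : ℕ) [Fact p.Prime] (hp : p ∈ ({11, 17, 19, 37, 43, 67, 163} : Finset ℕ))
    (hB : X1.TypeBRankOne W p)
    (_hD : ∃ Dh : PAdicHeightData W p, Dh.IsCanonical ∧ ¬ SchneiderConjecture Dh) : BSDp W p :=
  absurd hB (not_typeBRankOne_of_mem_positiveGenus hM hT W p hp)

/-! ## §3 WLOG forms of the crux `DegenerateLocusA2` (item 19086) over FOUR primes, BY NAME -/

/-- **WLOG `p ∈ {3, 5, 7, 13}`.** The crux `SlopeDichotomyA2.DegenerateLocusA2` is EQUIVALENT to its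
restriction to the four census primes — a finite conjunction of FOUR statements, one per prime (granted
Mazur 1978 Thm. 1 and the prime-degree isogeny `j`-table as the named hypotheses `hM`, `hT`); sharpens
`DegenerateLocusA2PrimeSupport.degenerateLocusA2_iff_of_mem_oddMazurPrimes` (eleven primes).
[cite: Mazur1978, Thm. 1 and table p. 129] [cite: CremonaAlgorithms1997, §3.8 p. 82] -/
theorem degenerateLocusA2_iff_of_mem_primeSupport (hM : mazur_isogeny_irreducible)
    (hT : primeDegreeIsogeny_jTable) :
    Theses.SlopeDichotomyA2.DegenerateLocusA2 ↔
      ∀ (W : WeierstrassCurve ℚ) [W.IsElliptic] [W.IsGloballyMinimal] (p : ℕ) [Fact p.Prime],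
        p ∈ ({3, 5, 7, 13} : Finset ℕ) → X1.TypeBRankOne W p →
          (∃ Dh : PAdicHeightData W p, Dh.IsCanonical ∧ ¬ SchneiderConjecture Dh) → BSDp W p := by
  refine ⟨fun h W _ _ p _ _ hB hD ↦ h W p hB hD, fun h W _ _ p _ hB hD ↦ ?_⟩
  exact h W p (mem_primeSupport_of_typeBRankOne hM hT W p hB) hB hD

/-- **WLOG `p = 3 ∨ p = 5 ∨ p = 7 ∨ p = 13`** (the same normal form with the membership unfolded).
[cite: Mazur1978, Thm. 1 and table p. 129] [cite: CremonaAlgorithms1997, §3.8 p. 82] -/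
theorem degenerateLocusA2_iff_of_eq_or (hM : mazur_isogeny_irreducible)
    (hT : primeDegreeIsogeny_jTable) :
    Theses.SlopeDichotomyA2.DegenerateLocusA2 ↔
      ∀ (W : WeierstrassCurve ℚ) [W.IsElliptic] [W.IsGloballyMinimal] (p : ℕ) [Fact p.Prime],
        (p = 3 ∨ p = 5 ∨ p = 7 ∨ p = 13) → X1.TypeBRankOne W p →
          (∃ Dh : PAdicHeightData W p, Dh.IsCanonical ∧ ¬ SchneiderConjecture Dh) → BSDp W p := by
  refine ⟨fun h W _ _ p _ _ hB hD ↦ h W p hB hD, fun h W _ _ p _ hB hD ↦ ?_⟩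
  exact h W p (eq_or_of_typeBRankOne hM hT W p hB) hB hD

/-- **WLOG `E` non-CM and `p ∈ {3, 5, 7, 13}`.** The crux is EQUIVALENT to its restriction to curves
WITHOUT complex multiplication at the four census primes (the CM members of the corner are never
degenerate: Bertrand, `DegenerateLocusA2PrimeSupport.not_degenerate_of_hasCM_of_typeBRankOne`, with the
Mordell–Weil rank supplied by GZK). [cite: Mazur1978, Thm. 1 and table p. 129]
[cite: CremonaAlgorithms1997, §3.8 p. 82] [cite: Bertrand1984ThetaCM, §3 Corollaire 1 (p. 21)] -/
theorem degenerateLocusA2_iff_nonCM_of_mem_primeSupport (hM : mazur_isogeny_irreducible)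
    (hT : primeDegreeIsogeny_jTable) (hBer : bertrand_pairing_self_ne_zero_of_hasCM_odd)
    (hGZK : rank_eq_analyticRank_of_analyticRank_le_one) :
    Theses.SlopeDichotomyA2.DegenerateLocusA2 ↔
      ∀ (W : WeierstrassCurve ℚ) [W.IsElliptic] [W.IsGloballyMinimal] (p : ℕ) [Fact p.Prime],
        ¬ W.HasCM → p ∈ ({3, 5, 7, 13} : Finset ℕ) → X1.TypeBRankOne W p →
          (∃ Dh : PAdicHeightData W p, Dh.IsCanonical ∧ ¬ SchneiderConjecture Dh) → BSDp W p := by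
  refine ⟨fun h W _ _ p _ _ _ hB hD ↦ h W p hB hD, fun h W _ _ p _ hB hD ↦ ?_⟩
  by_cases hCM : W.HasCM
  · exact absurd hD
      (DegenerateLocusA2PrimeSupport.not_degenerate_of_hasCM_of_typeBRankOne hBer hGZK W p hCM hB)
  · exact h W p hCM (mem_primeSupport_of_typeBRankOne hM hT W p hB) hB hD

/-! ## §4 The same normal forms for Schneider on corner A2 (K5 crux 6, item 19036) and for the leaf -/

/-- **Schneider on corner A2, WLOG `p ∈ {3, 5, 7, 13}`**: K5's crux `EisensteinPrimes.SchneiderOnX1TypeB`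
(item stmt-BirchSwinnertonDyer-19036) is EQUIVALENT to its restriction to the four census primes.
[cite: Mazur1978, Thm. 1 and table p. 129] [cite: CremonaAlgorithms1997, §3.8 p. 82] -/
theorem schneiderOnX1TypeB_iff_of_mem_primeSupport (hM : mazur_isogeny_irreducible)
    (hT : primeDegreeIsogeny_jTable) :
    Theses.EisensteinPrimes.SchneiderOnX1TypeB ↔
      ∀ (W : WeierstrassCurve ℚ) [W.IsElliptic] [W.IsGloballyMinimal] (p : ℕ) [Fact p.Prime],
        p ∈ ({3, 5, 7, 13} : Finset ℕ) → X1.TypeBRankOne W p →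
          ∀ Dh : PAdicHeightData W p, Dh.IsCanonical → SchneiderConjecture Dh := by
  refine ⟨fun h W _ _ p _ _ hB Dh hDh ↦ h W p hB Dh hDh, fun h W _ _ p _ hB Dh hDh ↦ ?_⟩
  exact h W p (mem_primeSupport_of_typeBRankOne hM hT W p hB) hB Dh hDh

/-- **Schneider on corner A2, WLOG `E` non-CM and `p ∈ {3, 5, 7, 13}`** (the CM members satisfy
Schneider by Bertrand). [cite: Mazur1978, Thm. 1 and table p. 129] [cite: CremonaAlgorithms1997, §3.8 p. 82]
[cite: Bertrand1984ThetaCM, §3 Corollaire 1 (p. 21)] -/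
theorem schneiderOnX1TypeB_iff_nonCM_of_mem_primeSupport (hM : mazur_isogeny_irreducible)
    (hT : primeDegreeIsogeny_jTable) (hBer : bertrand_pairing_self_ne_zero_of_hasCM_odd)
    (hGZK : rank_eq_analyticRank_of_analyticRank_le_one) :
    Theses.EisensteinPrimes.SchneiderOnX1TypeB ↔
      ∀ (W : WeierstrassCurve ℚ) [W.IsElliptic] [W.IsGloballyMinimal] (p : ℕ) [Fact p.Prime],
        ¬ W.HasCM → p ∈ ({3, 5, 7, 13} : Finset ℕ) → X1.TypeBRankOne W p →
          ∀ Dh : PAdicHeightData W p, Dh.IsCanonical → SchneiderConjecture Dh := by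
  refine ⟨fun h W _ _ p _ _ _ hB Dh hDh ↦ h W p hB Dh hDh, fun h W _ _ p _ hB Dh hDh ↦ ?_⟩
  by_cases hCM : W.HasCM
  · by_contra hS
    exact DegenerateLocusA2PrimeSupport.not_degenerate_of_hasCM_of_typeBRankOne hBer hGZK W p hCM hB
      ⟨Dh, hDh, hS⟩
  · exact h W p hCM (mem_primeSupport_of_typeBRankOne hM hT W p hB) hB Dh hDh

/-- **The rung-I1 leaf, WLOG `p ∈ {3, 5, 7, 13}`**: `SchneiderWeaken.TypeBRankOneUnridered` (`BSD(E,p)`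
on all of corner A2) is EQUIVALENT to its restriction to the four census primes.
[cite: Mazur1978, Thm. 1 and table p. 129] [cite: CremonaAlgorithms1997, §3.8 p. 82] -/
theorem typeBRankOneUnridered_iff_of_mem_primeSupport (hM : mazur_isogeny_irreducible)
    (hT : primeDegreeIsogeny_jTable) :
    SchneiderWeaken.TypeBRankOneUnridered ↔
      ∀ (W : WeierstrassCurve ℚ) [W.IsElliptic] [W.IsGloballyMinimal] (p : ℕ) [Fact p.Prime],
        p ∈ ({3, 5, 7, 13} : Finset ℕ) → X1.TypeBRankOne W p → BSDp W p := by
  refine ⟨fun h W _ _ p _ _ hB ↦ h W p hB, fun h W _ _ p _ hB ↦ ?_⟩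
  exact h W p (mem_primeSupport_of_typeBRankOne hM hT W p hB) hB

/-- **The rung-I1 leaf at any prime outside `{3, 5, 7, 13}` HOLDS** (vacuously: the corner is empty
there), in particular at `11, 17, 19, 37, 43, 67, 163`. [cite: Mazur1978, Thm. 1 and table p. 129]
[cite: CremonaAlgorithms1997, §3.8 p. 82] -/
theorem bsdp_of_typeBRankOne_of_not_mem (hM : mazur_isogeny_irreducible)
    (hT : primeDegreeIsogeny_jTable) (W : WeierstrassCurve ℚ) [W.IsElliptic] [W.IsGloballyMinimal]
    (p : ℕ) [Fact p.Prime] (hp : p ∉ ({3, 5, 7, 13} : Finset ℕ)) (hB : X1.TypeBRankOne W p) :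
    BSDp W p :=
  absurd hB (not_typeBRankOne_of_not_mem hM hT W p hp)

end Summit.BirchSwinnertonDyer.BirchSwinnertonDyer.Theorems.DegenerateLocusA2PrimeSupportSharp

end
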